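import Mathlib.Analysis.Calculus.ParametricIntegral
import Mathlib.Analysis.Calculus.ContDiff.Bounds
import Mathlib.Analysis.Calculus.IteratedDeriv.Lemmas
import Mathlib.MeasureTheory.Function.ContinuousMapDense
import Mathlib.MeasureTheory.Integral.Bochner.ContinuousLinearMap
import Literature.Analysis.Calculus.DirDerivOpenCommute                      -- ★ p850920 (LH3-p01 (g4)): `contDiffOn_dirDeriv`, `contDiffOn_iterate_dirDeriv`, `dirDeriv_iterate_comm_eqOn`, `iterate_dirDeriv_eqOn_of_eqOn`
import HarnessLib

/-!
# Parametric slice jets: the derivative of a parametric integral with uniform compact support, the commutation `∂_v ∂_s^a = ∂_s^a ∂_v` on an open set of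
# `Q × ℝ` in the curried one-real-variable form, and closure of jointly smooth families under a parameter derivative (Hörmander Thm. 1.1.8–1.1.9)

Topic `Analysis/Calculus`; namespace `Literature.Analysis.Calculus`.  THEOREMS ONLY (no `def`, no instance, no notation, no axiom, no named fact, no `sorry`); Mathlib + ★
`DirDerivOpenCommute` only.  Cell `pub/hodgecm-mathlib`, crux H413 (`stmt-HodgeConjecture-24833`), line LH3 (closer stub `stub_N9`), LETTER L1 clause (I₃) «jump relations,
all orders, all adapted words» — SPEC-I3 v1.1 (F0P3a-p08 (g23)) brick **(B-par)** «parametric differentiation under the two rank-one functionals», GENERIC HALF (LH3-plan (g3)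
RULING #16 (b′), 2026-09-02; author F0P3a-p04 (g24)).  The automorphic half is `Literature/NumberTheory/Automorphic/ArchRankOneOrbitalFamilyParam.lean`.

THE MATHEMATICS (three generic facts the word induction (B-trans) consumes).
* §1 **Derivative of a parametric integral with uniform compact support — the FORMULA.**  `μ` finite on compacts on a `T₂` space `Y`, `Ψ : P × V → F` smooth (`V` finite-dimensional),
  `y : Y → P` continuous; if `Ψ(y t, X) = 0` for `t ∉ S` (compact) and `X ∈ U ∈ 𝓝 X₀`, then `X ↦ ∫ Ψ(y t, X) dμ(t)` has derivative `∫ ∂_X Ψ(y t, X₀) dμ(t)` at `X₀`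
  (**`hasFDerivAt_integral_comp_of_contDiff_of_support`**; Mathlib `hasFDerivAt_integral_of_dominated_of_fderiv_le` with the bound `sup_{S × B̄} ‖∂_X Ψ‖ · 𝟙_S`), and so
  `∂_v ∫ Ψ(y t, X) = ∫ ∂_v Ψ(y t, X)` (**`fderiv_integral_comp_of_contDiff_of_support_apply`**).  The `C^∞` statement with the same hypotheses is ★
  `contDiffAt_integral_comp_of_contDiff_of_support` (`ArchLocalTorusOrbitalBlockSmooth` §1).
* §2 **Slice jets on `Q × ℝ`.**  For `G` `C^∞` on an open `U ⊆ Q × ℝ`: the `s`-jets of the slices `s ↦ G(q, s)` are the iterated directional derivatives of `G` along `(0, 1)`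
  (**`iteratedDeriv_slice_snd_eq_iterate_dirDeriv`**), the `q`-derivative of a slice is the directional derivative along `(v, 0)` (**`fderiv_slice_fst_apply`**), and — Schwarz,
  iterated (★ `dirDeriv_iterate_comm_eqOn`) — if `∂_v G(·, s)(q) = G₁(q, s)` on `U` then **`∂_v [q ↦ ∂_s^a G(q, s)] = ∂_s^a [s ↦ G₁(q, s)]`** at every point of `U`
  (**`fderiv_iteratedDeriv_slice_eq`**, the curried form (B-trans) reads with `G(q, ψ) = F(Θ_q)(ψ)`, `G₁(q, ψ) = F(∂_v Θ_q)(ψ)`).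
* §3 **Families.**  For `Θ : Q → X → F` with `ContDiff ℝ ∞ (uncurry Θ)` the parameter derivative `∂_v Θ q x := fderiv ℝ (q′ ↦ Θ q′ x) q v` is again jointly smooth
  (**`contDiff_uncurry_fderiv_apply`**, Mathlib `ContDiff.fderiv_apply`), it vanishes wherever `Θ` vanishes for all parameters (**`fderiv_apply_eq_zero_of_forall_eq_zero`**),
  and `q ↦ Θ q x` has derivative `∂_v Θ q x` along `v` (bookkeeping: **`hasFDerivAt_apply_of_contDiff_uncurry`**).
HONEST LABEL: generic calculus, count-neutral; HC_CM is proved only modulo the 7 printed citations (2 remaining: hLiu418 = `stmt-HodgeConjecture-24832`,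
h413 = `stmt-HodgeConjecture-24833`) until rung 0 closes.

## References
* [HormanderALPDO1] L. Hörmander, *The Analysis of Linear Partial Differential Operators I*, 2nd ed. (1990), §1.1 Thm. 1.1.8 (symmetry of mixed derivatives), Thm. 1.1.9
  (differentiation under the integral sign).
* [DeitmarEchterhoff2014] A. Deitmar, S. Echterhoff, *Principles of Harmonic Analysis*, 2nd ed. (2014), Lemma 9.3.3 (smooth compactly supported integrands).
-/

set_option autoImplicit false

noncomputable section

open MeasureTheory Set Filter Topology Function Metric
open scoped ContDiff

namespace Literature.Analysis.Calculus

/-! ## §1 The derivative of a parametric integral with uniform compact support: the formula -/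

section Integral

variable {Y : Type*} [TopologicalSpace Y] [T2Space Y] [MeasurableSpace Y] [OpensMeasurableSpace Y]
  {P : Type*} [NormedAddCommGroup P] [NormedSpace ℝ P]
  {V : Type*} [NormedAddCommGroup V] [NormedSpace ℝ V] [FiniteDimensional ℝ V]
  {F : Type*} [NormedAddCommGroup F] [NormedSpace ℝ F]

/-- **DIFFERENTIATION UNDER THE INTEGRAL SIGN, UNIFORM COMPACT SUPPORT — THE FORMULA.**  `μ` finite on compacts, `Ψ : P × V → F` smooth (`V` finite-dimensional), `y : Y → P`
continuous; if there are a compact `S ⊆ Y` and a neighbourhood `U` of `X₀` with `Ψ(y t, X) = 0` for `t ∉ S`, `X ∈ U`, then `X ↦ ∫_Y Ψ(y t, X) dμ(t)` has Fréchet derivative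
`∫_Y ∂_X Ψ(y t, ·)(X₀) dμ(t)` at `X₀` (Mathlib `hasFDerivAt_integral_of_dominated_of_fderiv_le` on a ball `B ⊆ U` around `X₀`: the derivative `∂_X Ψ(y t, X) = DΨ(y t, X) ∘ inr` is
continuous in `(t, X)`, bounded on the compact `S × B̄`, and vanishes for `t ∉ S`, `X ∈ B`). [cite: HormanderALPDO1, Thm. 1.1.9] [cite: DeitmarEchterhoff2014, Lemma 9.3.3] -/
theorem hasFDerivAt_integral_comp_of_contDiff_of_support (μ : Measure Y) [IsFiniteMeasureOnCompacts μ] (Ψ : P × V → F) (hΨ : ContDiff ℝ ∞ Ψ) (y : Y → P)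
    (hy : Continuous y) (X₀ : V) {S : Set Y} (hS : IsCompact S) {U : Set V} (hU : U ∈ 𝓝 X₀) (h0 : ∀ t ∉ S, ∀ X ∈ U, Ψ (y t, X) = 0) :
    HasFDerivAt (fun X : V => ∫ t, Ψ (y t, X) ∂μ) (∫ t, fderiv ℝ (fun X : V => Ψ (y t, X)) X₀ ∂μ) X₀ := by
  -- a ball `B = ball X₀ r` with `closedBall X₀ r ⊆ U`
  obtain ⟨r, hr, hrU⟩ : ∃ r > 0, closedBall X₀ r ⊆ U := nhds_basis_closedBall.mem_iff.1 hU
  have hBU : ball X₀ r ⊆ U := ball_subset_closedBall.trans hrU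
  -- the derivative family `F' X t = DΨ(y t, X) ∘ inr`
  set F' : V → Y → V →L[ℝ] F := fun X t => (fderiv ℝ Ψ (y t, X)).comp (ContinuousLinearMap.inr ℝ P V) with hF'
  have hΨd : Differentiable ℝ Ψ := hΨ.differentiable (by simp)
  have hdiff : ∀ t X, HasFDerivAt (fun X : V => Ψ (y t, X)) (F' X t) X := fun t X =>
    (hΨd (y t, X)).hasFDerivAt.comp X (hasFDerivAt_prodMk_right (𝕜 := ℝ) (y t) X)
  -- continuity of the integrand and of the derivative family in `t` (and jointly)
  have hpair : Continuous fun q : Y × V => (y q.1, q.2) := (hy.comp continuous_fst).prodMk continuous_snd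
  have hcont0 : ∀ X, Continuous fun t => Ψ (y t, X) := fun X => hΨ.continuous.comp (hy.prodMk continuous_const)
  have hDΨ : Continuous (fderiv ℝ Ψ) := hΨ.continuous_fderiv (by simp)
  have hcont1j : Continuous fun q : Y × V => F' q.2 q.1 := by
    simp only [hF']
    exact (hDΨ.comp hpair).clm_comp continuous_const
  have hcont1 : ∀ X, Continuous fun t => F' X t := fun X => hcont1j.comp (continuous_id.prodMk continuous_const)
  -- vanishing off `S`: the integrand for `X ∈ U`, the derivative for `X ∈ ball X₀ r`
  have hzero1 : ∀ t ∉ S, ∀ X ∈ ball X₀ r, F' X t = 0 := by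
    intro t ht X hX
    have hev : (fun X : V => Ψ (y t, X)) =ᶠ[𝓝 X] fun _ => (0 : F) :=
      (eventually_of_mem (isOpen_ball.mem_nhds hX) fun X' hX' => h0 t ht X' (hBU hX'))
    have h1 : HasFDerivAt (fun X : V => Ψ (y t, X)) (0 : V →L[ℝ] F) X := (hasFDerivAt_const (0 : F) X).congr_of_eventuallyEq hev
    exact (hdiff t X).unique h1
  have hsupp0 : ∀ X ∈ U, HasCompactSupport fun t => Ψ (y t, X) := fun X hX => HasCompactSupport.intro hS fun t ht => h0 t ht X hX
  have hsupp1 : ∀ X ∈ ball X₀ r, HasCompactSupport fun t => F' X t := fun X hX => HasCompactSupport.intro hS fun t ht => hzero1 t ht X hX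
  -- the uniform bound on `S × closedBall X₀ r`
  obtain ⟨B, hB⟩ := (hS.prod (isCompact_closedBall X₀ r)).exists_bound_of_continuousOn (f := fun q : Y × V => F' q.2 q.1) hcont1j.continuousOn
  have hX₀B : X₀ ∈ ball X₀ r := mem_ball_self hr
  have key := hasFDerivAt_integral_of_dominated_of_fderiv_le (𝕜 := ℝ) (μ := μ) (F := fun X t => Ψ (y t, X)) (F' := F') (x₀ := X₀)
    (bound := S.indicator fun _ => max B 0) (isOpen_ball.mem_nhds hX₀B)
    (eventually_of_mem hU fun X hX => ((hcont0 X).stronglyMeasurable_of_hasCompactSupport (hsupp0 X hX)).aestronglyMeasurable)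
    ((hcont0 X₀).integrable_of_hasCompactSupport (hsupp0 X₀ (mem_of_mem_nhds hU)))
    ((hcont1 X₀).stronglyMeasurable_of_hasCompactSupport (hsupp1 X₀ hX₀B)).aestronglyMeasurable
    (Eventually.of_forall fun t X hX => by
      by_cases ht : t ∈ S
      · rw [indicator_of_mem ht]
        exact (hB (t, X) ⟨ht, ball_subset_closedBall hX⟩).trans (le_max_left _ _)
      · rw [indicator_of_notMem ht, hzero1 t ht X hX, norm_zero])
    ((integrableOn_const (hS.measure_lt_top (μ := μ)).ne).integrable_indicator hS.measurableSet)
    (Eventually.of_forall fun t X _ => hdiff t X)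
  refine key.congr_fderiv (integral_congr_ae (Eventually.of_forall fun t => ?_))
  exact ((hdiff t X₀).fderiv).symm

/-- **`∂_v ∫ Ψ(y t, X) dμ(t) = ∫ ∂_v Ψ(y t, X) dμ(t)`** at `X₀`, under the hypotheses of `hasFDerivAt_integral_comp_of_contDiff_of_support` (evaluate the derivative CLM inside the
integral: the derivative family is continuous with compact support, hence integrable; Mathlib `ContinuousLinearMap.integral_apply`). [cite: HormanderALPDO1, Thm. 1.1.9] -/
theorem fderiv_integral_comp_of_contDiff_of_support_apply (μ : Measure Y) [IsFiniteMeasureOnCompacts μ] (Ψ : P × V → F) (hΨ : ContDiff ℝ ∞ Ψ) (y : Y → P)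
    (hy : Continuous y) (X₀ : V) {S : Set Y} (hS : IsCompact S) {U : Set V} (hU : U ∈ 𝓝 X₀) (h0 : ∀ t ∉ S, ∀ X ∈ U, Ψ (y t, X) = 0) (v : V) :
    fderiv ℝ (fun X : V => ∫ t, Ψ (y t, X) ∂μ) X₀ v = ∫ t, fderiv ℝ (fun X : V => Ψ (y t, X)) X₀ v ∂μ := by
  rw [(hasFDerivAt_integral_comp_of_contDiff_of_support μ Ψ hΨ y hy X₀ hS hU h0).fderiv]
  -- integrability of the derivative family at `X₀`: continuous with compact support
  obtain ⟨U', hU'U, hU'o, hX₀U'⟩ := _root_.mem_nhds_iff.1 hU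
  have hΨd : Differentiable ℝ Ψ := hΨ.differentiable (by simp)
  have hdiff : ∀ t X, HasFDerivAt (fun X : V => Ψ (y t, X)) ((fderiv ℝ Ψ (y t, X)).comp (ContinuousLinearMap.inr ℝ P V)) X := fun t X =>
    (hΨd (y t, X)).hasFDerivAt.comp X (hasFDerivAt_prodMk_right (𝕜 := ℝ) (y t) X)
  have heq : (fun t => fderiv ℝ (fun X : V => Ψ (y t, X)) X₀) = fun t => (fderiv ℝ Ψ (y t, X₀)).comp (ContinuousLinearMap.inr ℝ P V) :=
    funext fun t => (hdiff t X₀).fderiv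
  have hcont : Continuous fun t => (fderiv ℝ Ψ (y t, X₀)).comp (ContinuousLinearMap.inr ℝ P V) :=
    ((hΨ.continuous_fderiv (by simp)).comp (hy.prodMk continuous_const)).clm_comp continuous_const
  have hzero : ∀ t ∉ S, (fderiv ℝ Ψ (y t, X₀)).comp (ContinuousLinearMap.inr ℝ P V) = 0 := by
    intro t ht
    have hev : (fun X : V => Ψ (y t, X)) =ᶠ[𝓝 X₀] fun _ => (0 : F) :=
      eventually_of_mem (hU'o.mem_nhds hX₀U') fun X' hX' => h0 t ht X' (hU'U hX')
    exact (hdiff t X₀).unique ((hasFDerivAt_const (0 : F) X₀).congr_of_eventuallyEq hev)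
  have hint : Integrable (fun t => fderiv ℝ (fun X : V => Ψ (y t, X)) X₀) μ := by
    rw [heq]
    exact hcont.integrable_of_hasCompactSupport (HasCompactSupport.intro hS hzero)
  exact ContinuousLinearMap.integral_apply hint v

end Integral

/-! ## §2 Slice jets on `Q × ℝ`: `s`-jets of slices are iterated directional derivatives, and `∂_v` commutes with `∂_s^a` on an open set -/

section Slice

variable {Q : Type*} [NormedAddCommGroup Q] [NormedSpace ℝ Q] {F : Type*} [NormedAddCommGroup F] [NormedSpace ℝ F]

/-- The slice `s ↦ G(q, s)` of a function differentiable at `(q, s)` has derivative `DG(q, s)·(0, 1)` there (chain rule along `s ↦ (q, s)`). [cite: HormanderALPDO1, §1.1 (1.1.3)] -/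
theorem hasDerivAt_slice_snd {G : Q × ℝ → F} {x : Q × ℝ} (hG : DifferentiableAt ℝ G x) :
    HasDerivAt (fun s : ℝ => G (x.1, s)) (fderiv ℝ G x ((0 : Q), (1 : ℝ))) x.2 := by
  have hc : HasDerivAt (fun s : ℝ => ((x.1, s) : Q × ℝ)) ((0 : Q), (1 : ℝ)) x.2 := (hasDerivAt_const x.2 x.1).prodMk (hasDerivAt_id x.2)
  have hG' : HasFDerivAt G (fderiv ℝ G x) (x.1, x.2) := by rw [Prod.mk.eta]; exact hG.hasFDerivAt
  exact hG'.comp_hasDerivAt x.2 hc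

/-- **The `q`-derivative of a slice is a directional derivative**: `∂_v [q ↦ G(q, s)](q) = DG(q, s)·(v, 0)` for `G` differentiable at `(q, s)`. [cite: HormanderALPDO1, §1.1 (1.1.3)] -/
theorem fderiv_slice_fst_apply {G : Q × ℝ → F} {x : Q × ℝ} (hG : DifferentiableAt ℝ G x) (v : Q) :
    fderiv ℝ (fun q : Q => G (q, x.2)) x.1 v = fderiv ℝ G x (v, (0 : ℝ)) := by
  have hG' : HasFDerivAt G (fderiv ℝ G x) (x.1, x.2) := by rw [Prod.mk.eta]; exact hG.hasFDerivAt
  have h : HasFDerivAt (fun q : Q => G (q, x.2)) ((fderiv ℝ G x).comp (ContinuousLinearMap.inl ℝ Q ℝ)) x.1 :=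
    hG'.comp x.1 (hasFDerivAt_prodMk_left (𝕜 := ℝ) x.1 x.2)
  rw [h.fderiv, ContinuousLinearMap.comp_apply, ContinuousLinearMap.inl_apply]

/-- **`s`-JETS OF SLICES ARE ITERATED DIRECTIONAL DERIVATIVES ALONG `(0, 1)`**: for `G` `C^∞` on the open `U ⊆ Q × ℝ` and `x ∈ U`,
`∂_s^a [s ↦ G(x.1, s)](x.2) = (D_{(0,1)})^a G (x)`, `D_u h := y ↦ Dh(y)·u` (induction on `a`: both sides are local on `U`, and one `s`-derivative of a slice of a function `C^∞`
on `U` is the slice of `D_{(0,1)}` of it). [cite: HormanderALPDO1, §1.1 Thm. 1.1.8] -/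
theorem iteratedDeriv_slice_snd_eq_iterate_dirDeriv {U : Set (Q × ℝ)} (hU : IsOpen U) (a : ℕ) :
    ∀ {G : Q × ℝ → F}, ContDiffOn ℝ ∞ G U → ∀ x ∈ U,
      iteratedDeriv a (fun s : ℝ => G (x.1, s)) x.2 = ((fun h : Q × ℝ → F => fun y => fderiv ℝ h y ((0 : Q), (1 : ℝ)))^[a] G) x := by
  induction a with
  | zero => intro G _ x _; simp
  | succ a ih =>
    intro G hG x hx
    rw [Function.iterate_succ_apply, iteratedDeriv_succ']
    -- the two one-variable functions `deriv (slice of G)` and `slice of D_{(0,1)} G` agree near `x.2`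
    have hopen : IsOpen {s : ℝ | (x.1, s) ∈ U} := hU.preimage (continuous_const.prodMk continuous_id)
    have hev : deriv (fun s : ℝ => G (x.1, s)) =ᶠ[𝓝 x.2] fun s : ℝ => fderiv ℝ G (x.1, s) ((0 : Q), (1 : ℝ)) := by
      refine eventually_of_mem (hopen.mem_nhds (show (x.1, x.2) ∈ U by rw [Prod.mk.eta]; exact hx)) fun s hs => ?_
      have hd : DifferentiableAt ℝ G (x.1, s) := (hG.contDiffAt (hU.mem_nhds hs)).differentiableAt (by simp)
      exact (hasDerivAt_slice_snd (x := (x.1, s)) hd).deriv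
    rw [hev.iteratedDeriv_eq a]
    exact ih (contDiffOn_dirDeriv hU hG _) x hx

/-- **`∂_v ∂_s^a = ∂_s^a ∂_v` IN THE CURRIED FORM.**  `G` `C^∞` on the open `U ⊆ Q × ℝ`, `v ∈ Q`, and `G₁ : Q × ℝ → F` any function with `∂_v [q ↦ G(q, s)](q) = G₁(q, s)` at every
`(q, s) ∈ U`.  Then at every `x ∈ U` and for every order `a`:  **`∂_v [q ↦ ∂_s^a G(q, ·)(x.2)](x.1) = ∂_s^a [s ↦ G₁(x.1, s)](x.2)`**  — both sides are `(D_{(v,0)} D_{(0,1)}^a G)(x)`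
resp. `(D_{(0,1)}^a D_{(v,0)} G)(x)` by §2's dictionary, equal by Schwarz on `U` (★ `dirDeriv_iterate_comm_eqOn`). [cite: HormanderALPDO1, §1.1 Thm. 1.1.8] -/
theorem fderiv_iteratedDeriv_slice_eq {U : Set (Q × ℝ)} (hU : IsOpen U) {G G₁ : Q × ℝ → F} (hG : ContDiffOn ℝ ∞ G U) (v : Q)
    (hG₁ : ∀ y ∈ U, fderiv ℝ (fun q : Q => G (q, y.2)) y.1 v = G₁ y) {x : Q × ℝ} (hx : x ∈ U) (a : ℕ) :
    fderiv ℝ (fun q : Q => iteratedDeriv a (fun s : ℝ => G (q, s)) x.2) x.1 v = iteratedDeriv a (fun s : ℝ => G₁ (x.1, s)) x.2 := by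
  -- notation: `D h := D_{(0,1)} h`, `Ga := D^a G`, `H := D_{(v,0)} G`
  have hGa : ContDiffOn ℝ ∞ ((fun h : Q × ℝ → F => fun y => fderiv ℝ h y ((0 : Q), (1 : ℝ)))^[a] G) U := contDiffOn_iterate_dirDeriv hU _ a hG
  -- Step 1: near `x.1`, `q ↦ ∂_s^a G(q, ·)(x.2)` is the slice `q ↦ Ga (q, x.2)`
  have hopen : IsOpen {q : Q | (q, x.2) ∈ U} := hU.preimage (continuous_id.prodMk continuous_const)
  have hev : (fun q : Q => iteratedDeriv a (fun s : ℝ => G (q, s)) x.2) =ᶠ[𝓝 x.1]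
      fun q : Q => ((fun h : Q × ℝ → F => fun y => fderiv ℝ h y ((0 : Q), (1 : ℝ)))^[a] G) (q, x.2) := by
    refine eventually_of_mem (hopen.mem_nhds (show (x.1, x.2) ∈ U by rw [Prod.mk.eta]; exact hx)) fun q hq => ?_
    exact iteratedDeriv_slice_snd_eq_iterate_dirDeriv hU a hG (q, x.2) hq
  rw [hev.fderiv_eq]
  -- Step 2: the `q`-derivative of that slice is `D_{(v,0)} Ga (x)`
  have hd : DifferentiableAt ℝ ((fun h : Q × ℝ → F => fun y => fderiv ℝ h y ((0 : Q), (1 : ℝ)))^[a] G) x :=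
    (hGa.contDiffAt (hU.mem_nhds hx)).differentiableAt (by simp)
  rw [fderiv_slice_fst_apply hd v]
  -- Step 3: Schwarz, iterated: `D_{(v,0)} D^a G = D^a (D_{(v,0)} G)` on `U`
  rw [show fderiv ℝ ((fun h : Q × ℝ → F => fun y => fderiv ℝ h y ((0 : Q), (1 : ℝ)))^[a] G) x (v, (0 : ℝ)) =
      ((fun h : Q × ℝ → F => fun y => fderiv ℝ h y ((0 : Q), (1 : ℝ)))^[a] fun y => fderiv ℝ G y (v, (0 : ℝ))) x from
    dirDeriv_iterate_comm_eqOn hU (v, (0 : ℝ)) ((0 : Q), (1 : ℝ)) a hG hx]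
  -- Step 4: `D_{(v,0)} G = G₁` on `U`, so their `D^a` agree on `U`
  have hH : ContDiffOn ℝ ∞ (fun y => fderiv ℝ G y (v, (0 : ℝ))) U := contDiffOn_dirDeriv hU hG _
  have hHG₁ : EqOn (fun y => fderiv ℝ G y (v, (0 : ℝ))) G₁ U := fun y hy => by
    have hdy : DifferentiableAt ℝ G y := (hG.contDiffAt (hU.mem_nhds hy)).differentiableAt (by simp)
    show fderiv ℝ G y (v, (0 : ℝ)) = G₁ y
    rw [← fderiv_slice_fst_apply hdy v]
    exact hG₁ y hy
  rw [iterate_dirDeriv_eqOn_of_eqOn hU ((0 : Q), (1 : ℝ)) a hHG₁ hx]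
  -- Step 5: back to the `s`-jets of the slice of `G₁` (which is `C^∞` on `U`, being equal to `D_{(v,0)} G` there)
  exact (iteratedDeriv_slice_snd_eq_iterate_dirDeriv hU a (hH.congr fun y hy => (hHG₁ hy).symm) x hx).symm

/-- The global form of `fderiv_iteratedDeriv_slice_eq` (`U = univ`): for `G` `C^∞` on `Q × ℝ` with `∂_v [q ↦ G(q, s)](q) = G₁(q, s)` everywhere,
`∂_v [q ↦ ∂_s^a G(q, ·)(s)](q) = ∂_s^a [s ↦ G₁(q, s)](s)` everywhere. [cite: HormanderALPDO1, §1.1 Thm. 1.1.8] -/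
theorem fderiv_iteratedDeriv_slice_eq_of_contDiff {G G₁ : Q × ℝ → F} (hG : ContDiff ℝ ∞ G) (v : Q)
    (hG₁ : ∀ y : Q × ℝ, fderiv ℝ (fun q : Q => G (q, y.2)) y.1 v = G₁ y) (q : Q) (s : ℝ) (a : ℕ) :
    fderiv ℝ (fun q' : Q => iteratedDeriv a (fun s' : ℝ => G (q', s')) s) q v = iteratedDeriv a (fun s' : ℝ => G₁ (q, s')) s :=
  fderiv_iteratedDeriv_slice_eq isOpen_univ hG.contDiffOn v (fun y _ => hG₁ y) (x := (q, s)) (mem_univ _) a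

end Slice

/-! ## §3 Jointly smooth families are closed under a parameter derivative -/

section Family

variable {Q : Type*} [NormedAddCommGroup Q] [NormedSpace ℝ Q] {X : Type*} [NormedAddCommGroup X] [NormedSpace ℝ X]
  {F : Type*} [NormedAddCommGroup F] [NormedSpace ℝ F]

/-- **`∂_v Θ` is again jointly smooth**: for `Θ : Q → X → F` with `ContDiff ℝ ∞ (uncurry Θ)` and `v ∈ Q`, the family `(q, x) ↦ ∂_v [q′ ↦ Θ q′ x](q)` is `C^∞` on `Q × X`
(Mathlib `ContDiff.fderiv_apply`, as in ★ `NestedJet.contDiff_deriv_snd`). [cite: HormanderALPDO1, §1.1 Thm. 1.1.6 and (1.1.8)] -/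
theorem contDiff_uncurry_fderiv_apply {Θ : Q → X → F} (hΘ : ContDiff ℝ ∞ (Function.uncurry Θ)) (v : Q) :
    ContDiff ℝ ∞ (Function.uncurry fun (q : Q) (x : X) => fderiv ℝ (fun q' : Q => Θ q' x) q v) := by
  have hf : ContDiff ℝ ∞ (Function.uncurry fun (p : Q × X) (q' : Q) => Θ q' p.2) := hΘ.comp (contDiff_snd.prodMk (contDiff_snd.comp contDiff_fst))
  exact ContDiff.fderiv_apply (f := fun (p : Q × X) (q' : Q) => Θ q' p.2) (g := fun p => p.1) (k := fun _ => v) hf contDiff_fst contDiff_const le_rfl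

/-- `q ↦ Θ q x` is differentiable with `∂_v [q ↦ Θ q x](q)` its derivative along `v`, for a jointly smooth family (bookkeeping for consumers). [cite: HormanderALPDO1, §1.1 (1.1.3)] -/
theorem hasFDerivAt_apply_of_contDiff_uncurry {Θ : Q → X → F} (hΘ : ContDiff ℝ ∞ (Function.uncurry Θ)) (q : Q) (x : X) :
    HasFDerivAt (fun q' : Q => Θ q' x) (fderiv ℝ (fun q' : Q => Θ q' x) q) q := by
  have hd : DifferentiableAt ℝ (Function.uncurry Θ) (q, x) := (hΘ.differentiable (by simp)) _
  exact (hd.hasFDerivAt.comp q (hasFDerivAt_prodMk_left (𝕜 := ℝ) q x)).differentiableAt.hasFDerivAt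

end Family

section Support

variable {Q : Type*} [NormedAddCommGroup Q] [NormedSpace ℝ Q] {X : Type*} {F : Type*} [NormedAddCommGroup F] [NormedSpace ℝ F]

/-- **`∂_v Θ` vanishes wherever `Θ` vanishes for all parameters**: if `Θ q x = 0` for every `q` then `∂_v [q ↦ Θ q x](q) = 0` for every `q`; in particular a family supported in
one compact `C` for all parameters has all its parameter derivatives supported in `C`. [cite: HormanderALPDO1, §1.1 Thm. 1.1.9] -/
theorem fderiv_apply_eq_zero_of_forall_eq_zero {Θ : Q → X → F} {x : X} (h0 : ∀ q : Q, Θ q x = 0) (q : Q) (v : Q) :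
    fderiv ℝ (fun q' : Q => Θ q' x) q v = 0 := by
  have h : (fun q' : Q => Θ q' x) = fun _ => (0 : F) := funext h0
  rw [h, fderiv_const_apply]
  rfl

/-- Uniform compact support passes to the parameter derivative: `(∃ C compact, ∀ q x, x ∉ C → Θ q x = 0) → (∀ q x, x ∉ C → ∂_v Θ q x = 0)` with the same `C`.
[cite: HormanderALPDO1, §1.1 Thm. 1.1.9] -/
theorem forall_fderiv_apply_eq_zero_of_support {Θ : Q → X → F} {C : Set X} (h0 : ∀ (q : Q) (x : X), x ∉ C → Θ q x = 0) (v : Q) :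
    ∀ (q : Q) (x : X), x ∉ C → fderiv ℝ (fun q' : Q => Θ q' x) q v = 0 :=
  fun q _ hx => fderiv_apply_eq_zero_of_forall_eq_zero (fun q' => h0 q' _ hx) q v

end Support

end Literature.Analysis.Calculus

end
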